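import Literature.NumberTheory.EllipticCurves.Kato2004.MemberHullInputsTwo
import Literature.NumberTheory.EllipticCurves.Kato2004.AdditiveNoSplitCyclotomicTwistRankZeroShaUpperBoundFineSelmerAtTwoSharp
import HarnessLib

/-!
# Kato 2004 at `p = 2`, the MEMBER package for REDUCIBLE `E[2]` (twin of `MemberHullInputsTwo.lean`) for ADDITIVE reduction at `2` under (NST′) «no split multiplicative twist by `−1` or `−2` at `2`» instead of «potentially good» (ONE named fact; a READING; same seat)

Topic `NumberTheory/EllipticCurves`, sub-directory `Kato2004`. ONE named fact (`def … : Prop`, D-0014): the fact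
`exists_memberHullInputs_two` of `MemberHullInputsTwo.lean` (this seat GEN 10; reading R1–R12 there; D-audit hMH2@2 PASS) with its
hypothesis `0 ≤ padicValRat 2 W.j` (potentially good at `2`) REPLACED by (NST′)
`∀ d : ℚ, d = -1 ∨ d = -2 → ¬ (W.quadraticTwist d).HasSplitMultiplicativeReductionAtPrime 2` — exactly as the irreducible-`E[2]`
readings of `AdditiveNoSplitCyclotomicTwistRankZeroShaUpperBoundFineSelmerAtTwoSharp.lean` (this seat GEN 13, facts (NST)/(NST′),
steps T15–T16) generalise the sharp potentially-good reading. Written by the prover seat `bsd-2adic-addL2x` GEN 13.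

## R13 — why (NST′) suffices in R1–R12

In the member reading R1–R12 the potentially-good hypothesis is used at EXACTLY ONE place: **R8** («✓T3 (Thm. 12.5 (3) at `2` via
Kato 1999 Thm. 0.8, Rem. 12.7: `𝐇²_loc = 0` at a potentially good `2` …)»), i.e. the vanishing of the local term of Kato's Thm.
12.5 (3) at the primes `𝔭₊(𝔮)`, `𝔮 ∌ 2`, of step T3. By T15 (Kato 13.13: the dual of `𝐇²_loc(T)` is `E(ℚ₂(ζ_{2^∞}))[2^∞]`; Tate's
uniformisation: for an ADDITIVE `E` this is finite — `≤ 4` — unless some twist by `d ∈ {−1, 2, −2}` is split multiplicative) and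
T16 (when `E^{(2)}` is split the term is supported at the single prime `ker(κ^{−1}χ₂)`, a «`c = −1`» prime never among the
`𝔭₊(𝔮)`) of the GEN 13 file, the local term vanishes at every prime T3 uses as soon as (NST′) holds. Those two steps are
REDUCTION-TYPE statements about `E/ℚ₂` and do not use the irreducibility of `E[2]`: the member `W_K` is `ℚ`-isogenous to `W`,
hence `ℚ₂`-isogenous, so it has the same reduction type at `2` and the same twist types (`W_K^{(d)} ∼ W^{(d)}`, and split
multiplicative reduction is an isogeny invariant — Tate curves `E_q ∼ E_{q'}` iff `q^m = q'^n`, both split; more simply: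
`V₂W_K ≅ V₂W` as `Gal(ℚ̄/ℚ)`-representations, and both the local term `𝐇²_loc(V)` of Thm. 12.5 (3) and the finiteness of
`E(ℚ₂(ζ_{2^∞}))[2^∞]` depend only on the isogeny class); R8 at the member therefore holds under (NST′) at `W`. Every other step R1–R7, R9–R12 is reduction-type-free among ADDITIVE curves (checked in the
GEN 13 file's «the other steps» and T16 (d): R9's `2`-adic local term `⊕_{w∣2} H⁰(ℚ^cyc_w, W)^∨` is `ℤ₂`-finitely generated for
every `E`, which is all R9 uses; R12 = T7″/T8 is «local and torsion-agnostic» at an ADDITIVE `2` (`Ẽ_ns = 𝔾_a`); R1's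
`T^{G_{ℚ(ζ)}} = 0` is the finiteness of torsion over a number field). Conclusion: the SAME witnesses inhabit
`MemberHullInputs W_K 2 κ γ I 𝐲` under (NST′). Potentially good ⟹ (NST′) (no twist of a potentially good curve is multiplicative),
so this fact IMPLIES `exists_memberHullInputs_two` (recorded Summits-side).

WHAT IS NOT CLAIMED. As in `MemberHullInputsTwo.lean`; in addition nothing for the curves with a split multiplicative twist by `−1`
(there R8 carries the local term: `+ 2`) — and for a split twist by `−2` only the `+ 1` version would hold (not typed here); no
`_holds` (size XL). Flag for the referee (audit with hMH2@2 and the GEN 13 flags):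
`Kato-12.4-12.6-13.10-13.13-14.14-member-hull-reading-reducible-at-two-noSplitTwistNegOneNegTwo`.
Census (context): 61 of the 463 potentially multiplicative X5@2 classes are (NST′) with reducible `E[2]`.

THE LEAN STATEMENT. `exists_memberHullInputs_two` verbatim with the one hypothesis replaced.
-/

noncomputable section

open scoped NumberField TensorProduct
open Field IsDedekindDomain CongruenceSubgroup
open Literature.NumberTheory.GaloisRepresentations
open Literature.NumberTheory.EllipticCurves Literature.NumberTheory.EllipticCurves.ModularForms
open Literature.NumberTheory.EllipticCurves.Kato2004
open Literature.NumberTheory.EllipticCurves.Kato2004.EulerSystemValues Rat.HeightOneSpectrum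
open Literature.NumberTheory.EllipticCurves.IwasawaAlgebra

namespace Literature.NumberTheory.EllipticCurves.Kato2004

/-- **Kato's member package at `p = 2` for REDUCIBLE `E[2]` under (NST′)** — the fact `exists_memberHullInputs_two` (R1–R12 of
`MemberHullInputsTwo.lean`) with «potentially good at `2`» replaced by «no quadratic twist by `−1` or `−2` is split multiplicative
at `2`»: the potentially-good hypothesis enters R1–R12 only at R8 (the local term of Kato's **Thm. 12.5 (3)** in step T3), and by
**13.13** + Tate's uniformisation (T15) and the support computation **(12.5.1)** (T16) of
`AdditiveNoSplitCyclotomicTwistRankZeroShaUpperBoundFineSelmerAtTwoSharp.lean` that term vanishes at every prime T3 uses under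
(NST′); the member `W_K ∼ W` has the same reduction and twist types at `2` (isogeny invariance), and all other steps are
reduction-type-free among additive curves (R13 in the module docstring). Statement: for every globally minimal NON-CM `W/ℚ`,
ADDITIVE at `2`, with NO split multiplicative twist by `−1` or `−2` at `2`, `W[2]` REDUCIBLE, `L(W,1) ≠ 0`, `Ш(W/ℚ)` finite, there is
a globally minimal `W_K ∼ W` such that, granted (A) at `(W_K, 2)`, for the newform `f` and every `ι` there are `ZetaBody` witnesses
and, for every cyclotomic tower datum and THE lift `𝐲`, `MemberHullInputs W_K 2 κ γ I 𝐲` is inhabited. A READING; never stronger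
than what R1–R13 give; no `_holds` (size XL). Implies `exists_memberHullInputs_two`. Flag:
`Kato-12.4-12.6-13.10-13.13-14.14-member-hull-reading-reducible-at-two-noSplitTwistNegOneNegTwo`.
[cite: Kato2004Asterisque, §8.3 (p. 181), (12.2.1) (p. 220), Thm. 12.4 (1)(2) (p. 221), Thm. 12.5 (1)–(3) and (12.5.1) (pp. 221–222), Thm. 12.6 and Rem. 12.7 (p. 222), 13.8 (pp. 227–229), 13.9 and Lemma 13.10 (1) (pp. 229–230), 13.13–13.14 (pp. 233–234), Thm. 14.5 (1)(2) (pp. 236–237), §14.8 (p. 238), §14.14 and Lemma 14.15 (pp. 243–244), Prop. 14.16 (2) (pp. 244–245)]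
[cite: Kato1999Kodai, Thm. 0.8 (p. 318)]
[cite: SilvermanATAEC1994, V.3; Lemma V.5.2; Thm. V.5.3; Exercise 5.10 and 5.11]
[cite: Wuthrich2014, Lemma 12 (p. 395)]
[cite: GreenbergLNM1716, Prop. 4.13; §3 after Lemma 3.3]
[cite: Rubin2000, Ch. I §3–§4 and Thm. I.7.3; Ch. II Thm. 2.3] [cite: MazurRubin2004, Thm. 2.3.4]
[cite: Lim2017FineSelmer, §3 Thm. 3.5] [cite: CoatesSujatha2005, statement (A)]
[cite: BrunsHerzog1998, Prop. 1.4.1] [cite: SilvermanAEC2009, Prop. III.4.12, Thm. X.4.14] -/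
def exists_memberHullInputs_two_of_noSplitTwistNegOneNegTwo : Prop :=
  ∀ (W : WeierstrassCurve ℚ) [W.IsElliptic] [W.IsGloballyMinimal], ¬ W.HasCM →
    ¬ W.HasGoodReductionAtPrime 2 → ¬ W.HasMultiplicativeReductionAtPrime 2 →
    (∀ d : ℚ, d = -1 ∨ d = -2 →
      ¬ (W.quadraticTwist d).HasSplitMultiplicativeReductionAtPrime 2) →
    ¬ W.HasIrreducibleModPGaloisRep 2 →
    W.entireLFunction 1 ≠ 0 → Finite W.sha →
    ∃ (W' : WeierstrassCurve ℚ) (_ : W'.IsElliptic) (_ : W'.IsGloballyMinimal),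
      WeierstrassCurve.IsIsogenous W W' ∧
      ∀ [ContinuousSMul ℤ_[2] (W'.tateModule 2)] [Module.Free ℤ_[2] (W'.tateModule 2)]
        [Module.Finite ℤ_[2] (W'.tateModule 2)],
      (∀ (κ : ZpExtension ℚ 2), κ.IsCyclotomic →
        ∃ (γ : absoluteGaloisGroup ℚ) (D : W'.FineSelmerDualData κ γ),
          Module.Finite ℤ_[2] (RestrictScalars ℤ_[2] (IwasawaAlgebra 2) D.X)) →
      ∀ {N : ℕ} [NeZero N] (f : CuspForm (Gamma0 N) 2), IsNewformOf W f →
      ∀ (ι : (m : ℕ) → (CyclotomicField m ℚ →+* ℂ)),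
      ∃ (κ' : ℝ) (Λ' : ∀ (k : ℕ) (r : Finset (HeightOneSpectrum (𝓞 ℚ))),
          H1 (tateRep W' 2) (cycSubgroup 2 k r) →ₗ[ℤ_[2]] ℚ_[2] ⊗[ℚ] CyclotomicField (cycLevel 2 k r) ℚ)
        (c d a : ℤ) (A : ℕ)
        (z : ∀ (k : ℕ) (r : (cyclotomicLevelsRat 2 (badPlaces c d A N)).Ideals),
          H1 (tateRep W' 2) ((cyclotomicLevelsRat 2 (badPlaces c d A N)).level k r.1))
        (x : ∀ (k : ℕ) (r : (cyclotomicLevelsRat 2 (badPlaces c d A N)).Ideals),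
          CyclotomicField (cycLevel 2 k r.1) ℚ),
        κ' ≠ 0 ∧ 0 < A ∧ Int.gcd c (6 * 2 * A) = 1 ∧ Int.gcd d (6 * 2 * N) = 1 ∧
        ZetaBody W' 2 f ι κ' Λ' c d a A z x ∧
        ∀ (κ : ZpExtension ℚ 2) (γ : absoluteGaloisGroup ℚ) (hκ : κ.IsCyclotomic),
          κ.IsTopGenerator γ →
          ∀ (I : IwasawaH1Data W' 2 κ γ) (y : I.H),
            (∀ n : ℕ, I.proj n y = levelToLayerTwo W' hκ (badPlaces c d A N) n
              (z (n + 2) (cyclotomicLevelsRat 2 (badPlaces c d A N)).idealOne)) →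
            Nonempty (MemberHullInputs W' 2 κ γ I y)


end Literature.NumberTheory.EllipticCurves.Kato2004

end
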